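import Literature.Computability.Complexity.SkelExpr
import Literature.Computability.Complexity.SkeletonAssembly
import HarnessLib

/-!
# The clause generator of the skeleton reduction, I: the program

Literature / circuit complexity (serves `williams_acc` through the leaf
`Williams2014_fact_3_1_skeleton`; see `SkeletonTableau.lean`, `SkeletonAssembly.lean`). The
clause function `skAll L d n i b` must be computed from the query `⟨1ⁿ, ⟨bin i, b⟩⟩` in time
`a · ℓᶜ + a` with a UNIVERSAL exponent `c`. We obtain this from ONE universal generator
`ugen : Env × (ℕ × ℕ × Bool) → Clause ℕ` reading a description of the verifier (an
environment `dsc : Env` of `SkelExpr.lean`: a unary cap offset, the scalars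
`[K, inp, out, c₀, e, C, N₀, |P|]`, the instruction table and the goodness tables of table
mode) and the query: it appends to the environment, by the fixed expressions `prmExprs`, every
number the clause depends on (parameters of the tableau, the decoded clause index, the index
tuple of its constraint, the auxiliary base, the table-mode data), and the output stage `outG`
reads the clause off, evaluating the six variable addresses `addrExpr m` and the truth-table
constant `ttExpr` of the constraint by a `24`-way dispatch on the family. This file defines the
program and proves it polynomial-time on codes
(`codeFP_ugen`); its agreement with `skAll` is the sequel.

## References

* R. Williams, *Nonuniform ACC circuit lower bounds*, J. ACM 61 (2014), proof sketch of
  Fact 3.1 (p. 8) [Williams2014].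
* S. Arora, B. Barak, *Computational Complexity: A Modern Approach*, CUP 2009, §1.3
  [AroraBarak2009].
-/

namespace Literature.Computability.Complexity

namespace Tableau

open StackEvents FlatRun Benes _root_.Computability SkelExpr.NE

/-- The expressions of `SkelExpr.lean`. [folklore] -/
abbrev NE' : Type := SkelExpr.NE

namespace SkelGen

set_option maxHeartbeats 800000

/-! ### Truth tables as numbers -/

/-- The truth table of a six-bit predicate as a `64`-bit number. [folklore] -/
def ttOf (P : Bool → Bool → Bool → Bool → Bool → Bool → Bool) : ℕ :=
  ThreeCNF.ofBits (fun ρ => P (ThreeCNF.bit 0 ρ) (ThreeCNF.bit 1 ρ) (ThreeCNF.bit 2 ρ) (ThreeCNF.bit 3 ρ)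
    (ThreeCNF.bit 4 ρ) (ThreeCNF.bit 5 ρ)) 64

/-- Bit `ρ < 64` of `ttOf P` is `P` on row `ρ`. [folklore] -/
theorem bit_ttOf (P : Bool → Bool → Bool → Bool → Bool → Bool → Bool) {ρ : ℕ} (hρ : ρ < 64) :
    ThreeCNF.bit ρ (ttOf P) = P (ThreeCNF.bit 0 ρ) (ThreeCNF.bit 1 ρ) (ThreeCNF.bit 2 ρ) (ThreeCNF.bit 3 ρ)
      (ThreeCNF.bit 4 ρ) (ThreeCNF.bit 5 ρ) :=
  ThreeCNF.bit_ofBits _ 64 ρ hρ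

/-! ### Positions of the environment -/

section Pos
/-- Positions of the numbers of the environment (scalars, query, parameters, decoded index,
index tuple, auxiliary base, table-mode data). [folklore] -/
def pK : ℕ := 0
/-- `pINP` (auxiliary). [folklore] -/
def pINP : ℕ := 1
/-- `pOUT` (auxiliary). [folklore] -/
def pOUT : ℕ := 2
/-- `pC0` (auxiliary). [folklore] -/
def pC0 : ℕ := 3
/-- `pE` (auxiliary). [folklore] -/
def pE : ℕ := 4
/-- `pC` (auxiliary). [folklore] -/
def pC : ℕ := 5
/-- `pN0` (auxiliary). [folklore] -/
def pN0 : ℕ := 6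
/-- `pNP` (auxiliary). [folklore] -/
def pNP : ℕ := 7
/-- `pN` (auxiliary). [folklore] -/
def pN : ℕ := 8
/-- `pI` (auxiliary). [folklore] -/
def pI : ℕ := 9
/-- `pB` (auxiliary). [folklore] -/
def pB : ℕ := 10
/-- `pP2N` (auxiliary). [folklore] -/
def pP2N : ℕ := 11
/-- `pY` (auxiliary). [folklore] -/
def pY : ℕ := 12
/-- `pT` (auxiliary). [folklore] -/
def pT : ℕ := 13
/-- `pII` (auxiliary). [folklore] -/
def pII : ℕ := 14
/-- `pSEND` (auxiliary). [folklore] -/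
def pSEND : ℕ := 15
/-- `pKK` (auxiliary). [folklore] -/
def pKK : ℕ := 16
/-- `pS` (auxiliary). [folklore] -/
def pS : ℕ := 17
/-- `pL` (auxiliary). [folklore] -/
def pL : ℕ := 18
/-- `pW` (auxiliary). [folklore] -/
def pW : ℕ := 19
/-- `pS2` (auxiliary). [folklore] -/
def pS2 : ℕ := 20
/-- `pD` (auxiliary). [folklore] -/
def pD : ℕ := 21
/-- `pM` (auxiliary). [folklore] -/
def pM : ℕ := 22
/-- `pVM` (auxiliary). [folklore] -/
def pVM : ℕ := 23
/-- `pNC` (auxiliary). [folklore] -/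
def pNC : ℕ := 24
/-- `pNCL` (auxiliary). [folklore] -/
def pNCL : ℕ := 25
/-- `pIM` (auxiliary). [folklore] -/
def pIM : ℕ := 26
/-- `pID` (auxiliary). [folklore] -/
def pID : ℕ := 27
/-- `pJ` (auxiliary). [folklore] -/
def pJ : ℕ := 28
/-- `pRHO` (auxiliary). [folklore] -/
def pRHO : ℕ := 29
/-- `pT4` (auxiliary). [folklore] -/
def pT4 : ℕ := 30
/-- `pFAM` (auxiliary). [folklore] -/
def pFAM : ℕ := 31
/-- `pR1` (auxiliary). [folklore] -/
def pR1 : ℕ := 32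
/-- `pKI` (auxiliary). [folklore] -/
def pKI : ℕ := 33
/-- `pR2` (auxiliary). [folklore] -/
def pR2 : ℕ := 34
/-- `pSI` (auxiliary). [folklore] -/
def pSI : ℕ := 35
/-- `pR3` (auxiliary). [folklore] -/
def pR3 : ℕ := 36
/-- `pAI` (auxiliary). [folklore] -/
def pAI : ℕ := 37
/-- `pBI` (auxiliary). [folklore] -/
def pBI : ℕ := 38
/-- `pAUX` (auxiliary). [folklore] -/
def pAUX : ℕ := 39
/-- `pZ` (auxiliary). [folklore] -/
def pZ : ℕ := 40
/-- `pU` (auxiliary). [folklore] -/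
def pU : ℕ := 41
/-- `pSV0` (auxiliary). [folklore] -/
def pSV0 : ℕ := 42
/-- `pGOOD` (auxiliary). [folklore] -/
def pGOOD : ℕ := 43
end Pos

/-! ### The parameter expressions -/

/-- Shorthands for the variables. [folklore] -/
def K : NE' := var pK
/-- `N` (auxiliary). [folklore] -/
def N : NE' := var pN
/-- `KI` (auxiliary). [folklore] -/
def KI : NE' := var pKI
/-- `SI` (auxiliary). [folklore] -/
def SI : NE' := var pSI
/-- `AI` (auxiliary). [folklore] -/
def AI : NE' := var pAI
/-- `BI` (auxiliary). [folklore] -/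
def BI : NE' := var pBI
/-- `KK` (auxiliary). [folklore] -/
def KK : NE' := var pKK
/-- `S` (auxiliary). [folklore] -/
def S : NE' := var pS
/-- `L` (auxiliary). [folklore] -/
def L : NE' := var pL
/-- `S2` (auxiliary). [folklore] -/
def S2 : NE' := var pS2
/-- `D` (auxiliary). [folklore] -/
def D : NE' := var pD
/-- `Y` (auxiliary). [folklore] -/
def Y : NE' := var pY
/-- `II` (auxiliary). [folklore] -/
def II : NE' := var pII
/-- `SEND` (auxiliary). [folklore] -/
def SEND : NE' := var pSEND
/-- `NP` (auxiliary). [folklore] -/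
def NP : NE' := var pNP
/-- `INP` (auxiliary). [folklore] -/
def INP : NE' := var pINP
/-- `OUT` (auxiliary). [folklore] -/
def OUT : NE' := var pOUT

/-- Numerals. [folklore] -/
def c (n : ℕ) : NE' := cst n

/-- The expressions appended first: powers, parameters of the tableau, the decoded index, the
index tuple, the auxiliary base, table-mode data (positions `pP2N … pGOOD`). [folklore] -/
def prmExprs : List NE' :=
  [ pow2 N,                                                           -- 11 P2N = 2^n
    add (mul (var pC0) (var pP2N)) (var pC0),                          -- 12 Y
    add (mul (var pE) (add (add (add (mul (var pC0) (var pP2N)) (var pC0))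
      (add (add (mul (c 2) N) (c 2)) (var pY))) (c 1))) (var pE),           -- 13 T
    add (var pY) (add (mul (c 2) N) (c 2)),                            -- 14 I
    add (var pII) (var pT),                                            -- 15 Send
    add N (var pC),                                                    -- 16 k
    pow2 (var pKK),                                                    -- 17 S
    mul (c 2) (var pKK),                                               -- 18 L
    add (mul (c 2) (var pKK)) (c 4),                                   -- 19 W
    mul (c 2) (var pS),                                                -- 20 S2
    add (add (var pW) (var pNP)) (c 2),                                -- 21 D
    mul K (mul (var pS2) (mul (var pD) (var pD))),                     -- 22 M
    mul (c 16) (var pM),                                               -- 23 VMAIN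
    mul (c 32) (var pM),                                               -- 24 NC
    add N (mul (c 256) (var pNC)),                                     -- 25 NCl
    sub (var pI) N,                                                    -- 26 i - n
    div (var pIM) (c 256),                                             -- 27 id
    mod (var pIM) (c 256),                                             -- 28 j
    div (var pJ) (c 4),                                                -- 29 ρ
    mod (var pJ) (c 4),                                                -- 30 t
    mod (var pID) (c 32),                                              -- 31 fam
    div (var pID) (c 32),                                              -- 32 r1
    mod (var pR1) K,                                                   -- 33 κi
    div (var pR1) K,                                                   -- 34 r2
    mod (var pR2) (var pS2),                                           -- 35 si
    div (var pR2) (var pS2),                                           -- 36 r3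
    mod (var pR3) (var pD),                                            -- 37 ai
    div (var pR3) (var pD),                                            -- 38 bi
    add (add (var pVM) (mul (c 256) (var pID))) (mul (c 4) (var pRHO)), -- 39 aux
    div (var pIM) (add N (c 2)),                                       -- 40 z
    mod (var pIM) (add N (c 2)),                                       -- 41 u
    add N (mul (var pZ) (add N (c 1))),                                -- 42 sv n z 0
    tab2 N (var pZ) ]                                                  -- 43 good

/-! ### The family dispatch: addresses and truth tables -/

/-- The address of a tagged index tuple, as an expression (`enc t κ s a b`). [folklore] -/
def enc (t : ℕ) (dκ ds da db : NE') : NE' :=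
  add (c t) (mul (c 16) (add dκ (mul K (add ds (mul S2 (add da (mul D db)))))))

/-- The dummy address. [folklore] -/
def dum : NE' := enc 11 (c 0) (c 0) (c 0) (c 0)
/-- Address of a record bit `r κ ℓ p w`. [folklore] -/
def rvE (κ ℓ p w : NE') : NE' := enc 6 κ p ℓ w

/-- The dimension of network layer `ℓ`: `(dims k)[ℓ]`. [folklore] -/
def dimE : NE' := cond (lt AI KK) AI (sub (sub (mul (c 2) KK) (c 1)) AI)
/-- `base d p`. [folklore] -/
def baseE : NE' := cond (eq (mod (div SI (pow2 dimE)) (c 2)) (c 1)) (sub SI (pow2 dimE)) SI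
/-- `flipBit d p`. [folklore] -/
def flipE : NE' := cond (eq (mod (div SI (pow2 dimE)) (c 2)) (c 1)) (sub SI (pow2 dimE)) (add SI (pow2 dimE))
/-- `fKey i`. [folklore] -/
def fKeyE : NE' := cond (lt AI KK) (add (add KK (c 4)) AI) (add (c 3) (sub AI KK))

/-- Instruction table fields at `q = ai`: kind, register, symbol, target of pattern `o`.
[folklore] -/
def kindE : NE' := tab1 AI (c 0)
/-- `regE` (auxiliary). [folklore] -/
def regE : NE' := tab1 AI (c 1)
/-- `symE` (auxiliary). [folklore] -/
def symE : NE' := tab1 AI (c 2)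
/-- `tgtE` (auxiliary). [folklore] -/
def tgtE : NE' := tab1 AI (add (c 3) BI)
/-- `tgt0E` (auxiliary). [folklore] -/
def tgt0E : NE' := tab1 AI (c 3)

/-- Truth-table constants. [folklore] -/
def ttTrue : ℕ := ttOf fun _ _ _ _ _ _ => true
/-- `ttV1` (auxiliary). [folklore] -/
def ttV1 : ℕ := ttOf fun v _ _ _ _ _ => decide (v = true)
/-- `ttV0` (auxiliary). [folklore] -/
def ttV0 : ℕ := ttOf fun v _ _ _ _ _ => decide (v = false)
/-- `ttRecV1` (auxiliary). [folklore] -/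
def ttRecV1 : ℕ := ttOf fun t1 t0 p sy v _ => decide (t1 = false ∧ t0 = p ∧ sy = v)
/-- `ttRecV2c` (auxiliary). [folklore] -/
def ttRecV2c (b : Bool) : ℕ := ttOf fun t1 t0 sy _ _ _ => decide (t1 = false ∧ t0 = true ∧ sy = b)
/-- `ttRecV2x` (auxiliary). [folklore] -/
def ttRecV2x : ℕ := ttOf fun t1 t0 sy xj _ _ => decide (t1 = false ∧ t0 = true ∧ sy = xj)
/-- `ttNop2` (auxiliary). [folklore] -/
def ttNop2 : ℕ := ttOf fun t1 t0 _ _ _ _ => decide (t1 = false ∧ t0 = false)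
/-- `ttMnop` (auxiliary). [folklore] -/
def ttMnop : ℕ := ttOf fun u t1 t0 _ _ _ => decide (u = true → t1 = false ∧ t0 = false)
/-- `ttMpush` (auxiliary). [folklore] -/
def ttMpush (b : Bool) : ℕ := ttOf fun u t1 t0 sy _ _ => decide (u = true → t1 = false ∧ t0 = true ∧ sy = b)
/-- `ttMpop` (auxiliary). [folklore] -/
def ttMpop : ℕ := ttOf fun u t1 _ _ _ _ => decide (u = true → t1 = true)
/-- `ttRecF` (auxiliary). [folklore] -/
def ttRecF : ℕ := ttOf fun t1 t0 sy _ _ _ => decide (t1 = true ∧ t0 = true ∧ sy = true)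
/-- `ttLev` (auxiliary). [folklore] -/
def ttLev : ℕ := ttOf fun t1 t0 lv h' h _ =>
  decide (lv = (if t1 = false ∧ t0 = true then h' else if t1 = true ∧ t0 = true then h else false))
/-- `ttHcK` (auxiliary). [folklore] -/
def ttHcK : ℕ := ttOf fun t0 cc _ _ _ _ => decide (t0 = true → cc = false)
/-- `ttHstep` (auxiliary). [folklore] -/
def ttHstep : ℕ := ttOf fun t1 t0 a cc a' c' => decide (HStepRel t1 t0 a cc a' c')
/-- `ttU2` (auxiliary). [folklore] -/
def ttU2 : ℕ := ttOf fun u u' _ _ _ _ => decide (¬ (u = true ∧ u' = true))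
/-- `ttTrPopA` (auxiliary). [folklore] -/
def ttTrPopA (o : ℕ) : ℕ := ttOf fun u t0 sy u' _ _ =>
  decide ((u = true ∧ (if t0 then some sy else none) = oPat o) → u' = true)
/-- `ttTrPopB` (auxiliary). [folklore] -/
def ttTrPopB (o : ℕ) : ℕ := ttOf fun u t0 sy _ _ _ =>
  decide (¬ (u = true ∧ (if t0 then some sy else none) = oPat o))
/-- `ttTrA` (auxiliary). [folklore] -/
def ttTrA : ℕ := ttOf fun u u' _ _ _ _ => decide (u = true → u' = true)
/-- `ttTrB` (auxiliary). [folklore] -/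
def ttTrB : ℕ := ttOf fun u _ _ _ _ _ => decide (¬ u = true)
/-- `ttNet` (auxiliary). [folklore] -/
def ttNet : ℕ := ttOf fun r' s rf r _ _ => decide (r' = if s then rf else r)
/-- `ttLtStep` (auxiliary). [folklore] -/
def ttLtStep : ℕ := ttOf fun l' a b l _ _ => decide (l' = if a = b then l else b)
/-- `ttAeStep` (auxiliary). [folklore] -/
def ttAeStep : ℕ := ttOf fun e' e a b _ _ => decide (e' = (e && (a == b)))
/-- `ttAdj1` (auxiliary). [folklore] -/
def ttAdj1 : ℕ := ttOf fun t1' t0' t1 t0 e _ =>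
  decide (t1' = true → t0' = true → (t1 = false ∧ t0 = true ∧ e = true))
/-- `ttAdj2` (auxiliary). [folklore] -/
def ttAdj2 : ℕ := ttOf fun t1' t0' sy sy' _ _ => decide (t1' = true → t0' = true → sy = sy')
/-- `ttFirst` (auxiliary). [folklore] -/
def ttFirst : ℕ := ttOf fun t1 t0 _ _ _ _ => decide (¬ (t1 = true ∧ t0 = true))

/-- The range test of family `fam` as a `0/1` expression. [folklore] -/
def rangeE (fam : ℕ) : NE' :=
  match fam with
  | 0 => lt SI Y
  | 1 => lt SI (add (mul (c 2) N) (c 2))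
  | 2 => and' (lt SI S) (or' (and' (lt SI II) (not' (eq KI INP)))
      (or' (and' (eq SI SEND) (not' (eq KI OUT))) (lt SEND SI)))
  | 3 => and' (le II SI) (and' (lt SI SEND) (le AI NP))
  | 4 => c 1
  | 5 => and' (lt SI S) (lt AI KK)
  | 6 => and' (lt SI S) (le AI KK)
  | 7 => le AI KK
  | 8 => lt SI S
  | 9 => lt SI S
  | 10 => and' (lt SI S) (le AI KK)
  | 11 => c 1
  | 12 => and' (le II SI) (and' (le SI SEND) (and' (lt AI BI) (le BI NP)))
  | 13 => and' (le II SI) (and' (lt SI SEND) (and' (le AI NP) (lt BI (c 3))))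
  | 14 => c 1
  | 15 => and' (lt AI L) (and' (lt SI S) (lt BI (var pW)))
  | 16 => lt (add SI (c 1)) S
  | 17 => and' (lt (add SI (c 1)) S) (lt AI (add (mul (c 2) KK) (c 1)))
  | 18 => lt (add SI (c 1)) S
  | 19 => lt (add SI (c 1)) S
  | 20 => and' (lt (add SI (c 1)) S) (le AI KK)
  | 21 => lt (add SI (c 1)) S
  | 22 => lt (add SI (c 1)) S
  | 23 => c 1
  | _ => c 0

/-- The six addresses of family `fam`, as expressions (arbitrary out of range). [folklore] -/
def addrF (fam : ℕ) : List NE' :=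
  match fam with
  | 0 => [rvE INP (c 0) SI (c 0), rvE INP (c 0) SI (c 1), enc 1 (c 0) (sub (sub Y (c 1)) SI) (c 0) (c 0),
      rvE INP (c 0) SI (c 2), enc 2 (c 0) (sub (sub Y (c 1)) SI) (c 0) (c 0), dum]
  | 1 => [rvE INP (c 0) (add Y SI) (c 0), rvE INP (c 0) (add Y SI) (c 1), rvE INP (c 0) (add Y SI) (c 2),
      cond (lt SI (c 2)) dum (enc 0 (c 0) (sub (sub N (c 1)) (div (sub SI (c 2)) (c 2))) (c 0) (c 0)),
      dum, dum]
  | 2 => [rvE KI (c 0) SI (c 0), rvE KI (c 0) SI (c 1), dum, dum, dum, dum]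
  | 3 => [enc 3 (c 0) SI AI (c 0), rvE KI (c 0) SI (c 0), rvE KI (c 0) SI (c 1), rvE KI (c 0) SI (c 2), dum, dum]
  | 4 => [rvE OUT (c 0) SEND (c 0), rvE OUT (c 0) SEND (c 1), rvE OUT (c 0) SEND (c 2), dum, dum, dum]
  | 5 => [rvE KI (c 0) SI (add (add KK (c 4)) AI), dum, dum, dum, dum, dum]
  | 6 => [rvE KI (c 0) SI (c 0), rvE KI (c 0) SI (c 1), rvE KI (c 0) SI (add (c 3) AI),
      enc 4 KI (add SI (c 1)) AI (c 0), enc 4 KI SI AI (c 0), dum]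
  | 7 => [enc 4 KI (c 0) AI (c 0), dum, dum, dum, dum, dum]
  | 8 => [enc 5 KI SI (c 0) (c 0), dum, dum, dum, dum, dum]
  | 9 => [rvE KI (c 0) SI (c 1), enc 5 KI SI (add KK (c 1)) (c 0), dum, dum, dum, dum]
  | 10 => [rvE KI (c 0) SI (c 0), rvE KI (c 0) SI (c 1), enc 4 KI SI AI (c 0), enc 5 KI SI AI (c 0),
      enc 4 KI (add SI (c 1)) AI (c 0), enc 5 KI SI (add AI (c 1)) (c 0)]
  | 11 => [enc 3 (c 0) II (c 0) (c 0), dum, dum, dum, dum, dum]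
  | 12 => [enc 3 (c 0) SI AI (c 0), enc 3 (c 0) SI BI (c 0), dum, dum, dum, dum]
  | 13 => [enc 3 (c 0) SI AI (c 0),
      cond (eq kindE (c 2)) (rvE regE (c 0) SI (c 1)) (cond (le tgt0E NP) (enc 3 (c 0) (add SI (c 1)) tgt0E (c 0)) dum),
      cond (eq kindE (c 2)) (rvE regE (c 0) SI (c 2)) dum,
      cond (eq kindE (c 2)) (cond (le tgtE NP) (enc 3 (c 0) (add SI (c 1)) tgtE (c 0)) dum) dum,
      dum, dum]
  | 14 => [enc 3 (c 0) SEND NP (c 0), dum, dum, dum, dum, dum]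
  | 15 => [rvE KI (add AI (c 1)) SI BI, enc 7 KI baseE AI (c 0), rvE KI AI flipE BI, rvE KI AI SI BI, dum, dum]
  | 16 => [enc 8 KI SI (c 0) (c 0), dum, dum, dum, dum, dum]
  | 17 => [enc 8 KI SI (add AI (c 1)) (c 0), rvE KI L SI fKeyE, rvE KI L (add SI (c 1)) fKeyE,
      enc 8 KI SI AI (c 0), dum, dum]
  | 18 => [enc 8 KI SI (add (mul (c 2) KK) (c 1)) (c 0), dum, dum, dum, dum, dum]
  | 19 => [enc 9 KI SI (c 0) (c 0), dum, dum, dum, dum, dum]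
  | 20 => [enc 9 KI SI (add AI (c 1)) (c 0), enc 9 KI SI AI (c 0), rvE KI L SI (add (c 3) AI),
      rvE KI L (add SI (c 1)) (add (c 3) AI), dum, dum]
  | 21 => [rvE KI L (add SI (c 1)) (c 0), rvE KI L (add SI (c 1)) (c 1), rvE KI L SI (c 0), rvE KI L SI (c 1),
      enc 9 KI SI (add KK (c 1)) (c 0), dum]
  | 22 => [rvE KI L (add SI (c 1)) (c 0), rvE KI L (add SI (c 1)) (c 1), rvE KI L SI (c 2),
      rvE KI L (add SI (c 1)) (c 2), dum, dum]
  | 23 => [rvE KI L (c 0) (c 0), rvE KI L (c 0) (c 1), dum, dum, dum, dum]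
  | _ => [dum, dum, dum, dum, dum, dum]

/-- The truth table of family `fam` in range, as an expression (selecting constants).
[folklore] -/
def ttF (fam : ℕ) : NE' :=
  match fam with
  | 0 => c ttRecV1
  | 1 => cond (eq SI (c 0)) (c (ttRecV2c true)) (cond (eq SI (c 1)) (c (ttRecV2c false)) (c ttRecV2x))
  | 2 => c ttNop2
  | 3 => cond (eq kindE (c 1)) (cond (eq regE KI) (cond (eq symE (c 1)) (c (ttMpush true)) (c (ttMpush false)))
        (c ttMnop)) (cond (eq kindE (c 2)) (cond (eq regE KI) (c ttMpop) (c ttMnop)) (c ttMnop))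
  | 4 => c ttRecF
  | 5 => cond (SkelExpr.NE.bit AI SI) (c ttV1) (c ttV0)
  | 6 => c ttLev
  | 7 => c ttV0
  | 8 => c ttV1
  | 9 => c ttHcK
  | 10 => c ttHstep
  | 11 => c ttV1
  | 12 => c ttU2
  | 13 => cond (eq kindE (c 2))
      (cond (le tgtE NP)
        (cond (eq BI (c 0)) (c (ttTrPopA 0)) (cond (eq BI (c 1)) (c (ttTrPopA 1)) (c (ttTrPopA 2))))
        (cond (eq BI (c 0)) (c (ttTrPopB 0)) (cond (eq BI (c 1)) (c (ttTrPopB 1)) (c (ttTrPopB 2)))))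
      (cond (eq BI (c 0)) (cond (le tgt0E NP) (c ttTrA) (c ttTrB)) (c ttTrue))
  | 14 => c ttV1
  | 15 => c ttNet
  | 16 => c ttV0
  | 17 => c ttLtStep
  | 18 => c ttV1
  | 19 => c ttV1
  | 20 => c ttAeStep
  | 21 => c ttAdj1
  | 22 => c ttAdj2
  | 23 => c ttFirst
  | _ => c ttTrue

/-- Dispatch on the family variable among `24` expressions. [folklore] -/
def dispatch (f : ℕ → NE') : NE' :=
  (List.range 24).foldr (fun fam acc => cond (eq (var pFAM) (c fam)) (f fam) acc) (f 24)

/-- Address `m < 6` of the constraint, dispatched on the family. [folklore] -/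
def addrExpr (m : ℕ) : NE' := dispatch fun fam => (addrF fam).getD m dum

/-- Truth table of the constraint (all-true out of range), dispatched on the family.
[folklore] -/
def ttExpr : NE' := dispatch fun fam => cond (rangeE fam) (ttF fam) (c ttTrue)

/-- All appended expressions (the parameters; the addresses and the truth table are read by the
output stage directly). [folklore] -/
def allExprs : List NE' := prmExprs

/-! ### The output stage -/

/-- A literal from two expressions: variable and polarity (`≠ 0`). [folklore] -/
def litOf (a p : NE') (x : SkelExpr.Env) : Literal ℕ := (eval a x, !decide (eval p x = 0))

/-- Polarity expression of literal `m` of the blocking clause of row `ρ`: `¬ bit m ρ`.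
[folklore] -/
def polE (m : ℕ) : NE' := not' (SkelExpr.NE.bit (c m) (var pRHO))

/-- The compiled clause of the constraint in generic mode: tautology if the predicate holds on
the row, else chain clause `t`. [folklore] -/
noncomputable def genClause (x : SkelExpr.Env) : Clause ℕ :=
  if eval (SkelExpr.NE.bit (var pRHO) ttExpr) x = 0 then
    (if eval (var pT4) x = 0 then [litOf (addrExpr 0) (polE 0) x, litOf (addrExpr 1) (polE 1) x, litOf (var pAUX) (c 1) x]
     else if eval (var pT4) x = 1 then
      [litOf (var pAUX) (c 0) x, litOf (addrExpr 2) (polE 2) x, litOf (add (var pAUX) (c 1)) (c 1) x]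
     else if eval (var pT4) x = 2 then
      [litOf (add (var pAUX) (c 1)) (c 0) x, litOf (addrExpr 3) (polE 3) x, litOf (add (var pAUX) (c 2)) (c 1) x]
     else [litOf (add (var pAUX) (c 2)) (c 0) x, litOf (addrExpr 4) (polE 4) x, litOf (addrExpr 5) (polE 5) x])
  else tautClause

/-- The clause in generic mode. [folklore] -/
noncomputable def genOut (x : SkelExpr.Env) : Clause ℕ :=
  if eval (lt (var pI) N) x = 0 then
    (if eval (lt (var pI) (var pNCL)) x = 0 then tautClause else genClause x)
  else [litOf (mul (mul (c 16) K) (var pI)) (var pB) x]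

/-- The ladder clause in table mode. [folklore] -/
noncomputable def tabLadder (x : SkelExpr.Env) : Clause ℕ :=
  if eval (var pU) x = 0 then [litOf (var pSV0) (c 0) x]
  else if eval (le (var pU) N) x = 0 then
    (if eval (eq (var pU) (add N (c 1))) x = 0 then tautClause else [litOf (add (var pSV0) N) (c 1) x])
  else [litOf (add (var pSV0) (var pU)) (c 0) x, litOf (add (var pSV0) (sub (var pU) (c 1))) (c 1) x,
    litOf (sub (var pU) (c 1)) (not' (SkelExpr.NE.bit (sub (var pU) (c 1)) (var pZ))) x]

/-- The clause in table mode. [folklore] -/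
noncomputable def tabOut (x : SkelExpr.Env) : Clause ℕ :=
  if eval (lt (var pI) N) x = 0 then
    (if eval (lt (var pZ) (var pP2N)) x = 0 then tautClause
     else (if eval (var pGOOD) x = 0 then tabLadder x else tautClause))
  else [litOf (var pI) (var pB) x]

/-- The output stage. [folklore] -/
noncomputable def outG (x : SkelExpr.Env) : Clause ℕ :=
  if eval (lt N (var pN0)) x = 0 then genOut x else tabOut x

/-! ### The generator -/

/-- The query type and its code (`encodeSkelQuery`). [folklore] -/
abbrev Query : Type := ℕ × ℕ × Bool
/-- The code of a query. [folklore] -/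
def qE : Query → List Bool := CodeFP.pairE CodeFP.unE (CodeFP.pairE CodeFP.natE CodeFP.bitE)

/-- The initial environment: cap `cap₀ + n`, numbers `scalars ++ [n, i, b]`, the tables.
[folklore] -/
def initEnv (p : SkelExpr.Env × Query) : SkelExpr.Env :=
  (p.1.1 + p.2.1, (p.1.2.1 ++ [p.2.1, p.2.2.1, if p.2.2.2 then 1 else 0], p.1.2.2))

/-- **The universal clause generator.** [folklore] -/
noncomputable def ugen (p : SkelExpr.Env × Query) : Clause ℕ := outG (snocs allExprs (initEnv p))

/-! ### Polynomial time on codes -/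

section Proofs

open CodeFP

/-- The code of the input of the generator. [folklore] -/
def inE : SkelExpr.Env × Query → List Bool := CodeFP.pairE SkelExpr.envE qE
/-- The code of a literal and of a clause. [folklore] -/
abbrev litE : Literal ℕ → List Bool := CodeFP.pairE CodeFP.natE CodeFP.bitE
/-- The code of a clause (`encodingClause`). [folklore] -/
def clE : Clause ℕ → List Bool := CodeFP.listE litE

/-- The initial environment is computed on codes. [folklore] -/
theorem codeFP_initEnv : CodeFP inE SkelExpr.envE initEnv := by
  have hn : CodeFP inE unE (fun p => p.2.1) := (snd _ _).fst'
  have hi : CodeFP inE natE (fun p => p.2.2.1) := (snd _ _).snd'.fst'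
  have hb : CodeFP inE natE (fun p => if p.2.2.2 then 1 else 0) :=
    ((snd _ _).snd'.snd').ite (const _ 1) (const _ 0)
  have h1 : CodeFP inE unE (fun p => p.1.1 + p.2.1) := unAdd.comp ((fst _ _).fst'.pair hn)
  have h2 : CodeFP inE (rawE natE) (fun p => p.1.2.1 ++ [p.2.1, p.2.2.1, if p.2.2.2 then 1 else 0]) :=
    (rawAppend natE).comp ((fst _ _).snd'.fst'.pair ((rawCons natE).comp ((natOfUn.comp hn).pair
      ((rawCons natE).comp (hi.pair ((rawSingleton natE).comp hb))))))
  exact (h1.pair (h2.pair (fst _ _).snd'.snd')).congr fun _ => rfl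

/-- A literal of two expressions is computed on codes. [folklore] -/
theorem codeFP_litOf (a p : NE') : CodeFP SkelExpr.envE litE (litOf a p) :=
  ((codeFP_eval a).pair (natEq.comp ((codeFP_eval p).pair (const SkelExpr.envE 0))).not).congr fun _ => rfl

/-- A one-literal clause. [folklore] -/
theorem codeFP_cl1 {l : SkelExpr.Env → Literal ℕ} (h : CodeFP SkelExpr.envE litE l) : CodeFP SkelExpr.envE (rawE litE) (fun x => [l x]) :=
  (rawSingleton litE).comp h
/-- A three-literal clause. [folklore] -/
theorem codeFP_cl3 {l₁ l₂ l₃ : SkelExpr.Env → Literal ℕ} (h₁ : CodeFP SkelExpr.envE litE l₁) (h₂ : CodeFP SkelExpr.envE litE l₂)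
    (h₃ : CodeFP SkelExpr.envE litE l₃) : CodeFP SkelExpr.envE (rawE litE) (fun x => [l₁ x, l₂ x, l₃ x]) := by
  have h3 : CodeFP SkelExpr.envE (rawE litE) (fun x => [l₃ x]) := (rawSingleton litE).comp h₃
  have h23 : CodeFP SkelExpr.envE (rawE litE) (fun x => [l₂ x, l₃ x]) :=
    ((rawCons litE).comp (h₂.pair h3)).congr fun _ => rfl
  exact ((rawCons litE).comp (h₁.pair h23)).congr fun _ => rfl
/-- The tautology. [folklore] -/
theorem codeFP_taut : CodeFP SkelExpr.envE (rawE litE) (fun _ : SkelExpr.Env => tautClause) := const SkelExpr.envE tautClause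

/-- Branching on an expression being `0`. [folklore] -/
theorem codeFP_ite0 {β : Type} {eβ : β → List Bool} (e : NE') {g h : SkelExpr.Env → β} (hg : CodeFP SkelExpr.envE eβ g)
    (hh : CodeFP SkelExpr.envE eβ h) : CodeFP SkelExpr.envE eβ (fun x => if eval e x = 0 then g x else h x) :=
  ((natEq.comp ((codeFP_eval e).pair (const SkelExpr.envE 0))).ite hg hh).congr fun x => by
    simp only [decide_eq_true_eq]

/-- Branching on an expression being a constant. [folklore] -/
theorem codeFP_iteC {β : Type} {eβ : β → List Bool} (e : NE') (k : ℕ) {g h : SkelExpr.Env → β} (hg : CodeFP SkelExpr.envE eβ g)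
    (hh : CodeFP SkelExpr.envE eβ h) : CodeFP SkelExpr.envE eβ (fun x => if eval e x = k then g x else h x) :=
  ((natEq.comp ((codeFP_eval e).pair (const SkelExpr.envE k))).ite hg hh).congr fun x => by
    simp only [decide_eq_true_eq]

/-- The generic compiled clause is computed on codes (raw). [folklore] -/
theorem codeFP_genClause : CodeFP SkelExpr.envE (rawE litE) genClause :=
  (codeFP_ite0 _ (codeFP_ite0 _ (codeFP_cl3 (codeFP_litOf _ _) (codeFP_litOf _ _) (codeFP_litOf _ _))
    (codeFP_iteC _ 1 (codeFP_cl3 (codeFP_litOf _ _) (codeFP_litOf _ _) (codeFP_litOf _ _))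
      (codeFP_iteC _ 2 (codeFP_cl3 (codeFP_litOf _ _) (codeFP_litOf _ _) (codeFP_litOf _ _))
        (codeFP_cl3 (codeFP_litOf _ _) (codeFP_litOf _ _) (codeFP_litOf _ _))))) codeFP_taut).congr
    fun _ => rfl

/-- The generic clause is computed on codes (raw). [folklore] -/
theorem codeFP_genOut : CodeFP SkelExpr.envE (rawE litE) genOut :=
  (codeFP_ite0 _ (codeFP_ite0 _ codeFP_taut codeFP_genClause) (codeFP_cl1 (codeFP_litOf _ _))).congr fun _ => rfl

/-- The ladder clause is computed on codes (raw). [folklore] -/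
theorem codeFP_tabLadder : CodeFP SkelExpr.envE (rawE litE) tabLadder :=
  (codeFP_ite0 _ (codeFP_cl1 (codeFP_litOf _ _)) (codeFP_ite0 _ (codeFP_ite0 _ codeFP_taut (codeFP_cl1 (codeFP_litOf _ _)))
    (codeFP_cl3 (codeFP_litOf _ _) (codeFP_litOf _ _) (codeFP_litOf _ _)))).congr fun _ => rfl

/-- The table clause is computed on codes (raw). [folklore] -/
theorem codeFP_tabOut : CodeFP SkelExpr.envE (rawE litE) tabOut :=
  (codeFP_ite0 _ (codeFP_ite0 _ codeFP_taut (codeFP_ite0 _ codeFP_tabLadder codeFP_taut))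
    (codeFP_cl1 (codeFP_litOf _ _))).congr fun _ => rfl

/-- The output stage is computed on codes. [folklore] -/
theorem codeFP_outG : CodeFP SkelExpr.envE clE outG :=
  (listOfRaw litE).comp ((codeFP_ite0 _ codeFP_genOut codeFP_tabOut).congr fun _ => rfl)

/-- **The universal clause generator is computed on codes in polynomial time.**
[cite: AroraBarak2009, §1.3] -/
theorem codeFP_ugen : CodeFP inE clE ugen :=
  (codeFP_outG.comp ((codeFP_snocs allExprs).comp codeFP_initEnv)).congr fun _ => rfl

end Proofs

end SkelGen

end Tableau

end Literature.Computability.Complexity
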